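import Summits.Ventures.DiscreteObjects.UnitDistance.FieldPlanes
import Mathlib.NumberTheory.Real.Irrational
import HarnessLib

/-!
# Triangles in field planes: `Γ(K²)` contains a triangle iff `√3 ∈ K` (cell `pub-namedobj`, target (U), seat udg g12)

Framing (verbatim for the cell): lottery ticket; floor = certified bounds/negative ranges.

For a subfield `K ⊆ ℝ`, the unit-distance graph on `K²` (`planeUnitDistanceGraph.induce (fieldPoints K)`) has a triangle
(a `3`-clique, i.e. a unit equilateral triangle with vertices in `K²`) iff `√3 ∈ K`: if `p, q, r ∈ K²` are pairwise at distance `1`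
then `t = 2·det(q − p, r − p) ∈ K` has `t² = 4(|u|²|w|² − ⟨u,w⟩²) = 4(1 − 1/4) = 3`; conversely `(0,0), (1,0), (1/2, √3/2)`.
Elements of `ℚ(√d)` are `x + y√d` (`exists_rat_of_mem_adjoin_sqrt`), whence `√3 ∉ ℚ(√d)` as soon as `√d` and `√(3d)` are
irrational (`sqrt3_not_mem_adjoin_sqrt`), e.g. `d = 7, 11, 23, 35`: every unit-distance graph with coordinates in such a `ℚ(√d)`
is TRIANGLE-FREE (`cliqueFree_three_plane_sqrt11` …).  In particular the 4-chromatic witness of `PlaneSqrt11Four.lean` is a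
triangle-free 4-chromatic unit-distance graph.  Replication-grade mathematics (Madore arXiv:1509.07023 Prop. 4.2 proves the
triangle-freeness of `ℚ(√7)²` by the same rotation argument); the general `iff` packaging is ours, no novelty claimed.
-/

noncomputable section

namespace Summit.Ventures.DiscreteObjects.UnitDistance

open SimpleGraph IntermediateField
open scoped IntermediateField

/-- Squared distance in the plane in coordinates. -/
theorem dist_sq_fin2 (p q : EuclideanSpace ℝ (Fin 2)) : dist p q ^ 2 = (p 0 - q 0) ^ 2 + (p 1 - q 1) ^ 2 := by
  rw [EuclideanSpace.dist_sq_eq, Fin.sum_univ_two, Real.dist_eq, Real.dist_eq, sq_abs, sq_abs]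

/-- The algebraic core: for a unit triangle `p, q, r`, twice the determinant of `(q − p, r − p)` squares to `3`. -/
theorem sq_two_det_eq_three {p q r : EuclideanSpace ℝ (Fin 2)} (hpq : dist p q = 1) (hpr : dist p r = 1)
    (hqr : dist q r = 1) : (2 * ((q 0 - p 0) * (r 1 - p 1) - (q 1 - p 1) * (r 0 - p 0))) ^ 2 = 3 := by
  have e1 : (p 0 - q 0) ^ 2 + (p 1 - q 1) ^ 2 = 1 := by rw [← dist_sq_fin2, hpq, one_pow]
  have e2 : (p 0 - r 0) ^ 2 + (p 1 - r 1) ^ 2 = 1 := by rw [← dist_sq_fin2, hpr, one_pow]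
  have e3 : (q 0 - r 0) ^ 2 + (q 1 - r 1) ^ 2 = 1 := by rw [← dist_sq_fin2, hqr, one_pow]
  linear_combination (4 * ((p 0 - r 0) ^ 2 + (p 1 - r 1) ^ 2) -
      (1 + 2 * ((q 0 - p 0) * (r 0 - p 0) + (q 1 - p 1) * (r 1 - p 1)))) * e1 +
    (3 - 2 * ((q 0 - p 0) * (r 0 - p 0) + (q 1 - p 1) * (r 1 - p 1))) * e2 +
    (1 + 2 * ((q 0 - p 0) * (r 0 - p 0) + (q 1 - p 1) * (r 1 - p 1))) * e3

/-- A unit triangle with vertices in `K²` puts `√3` in `K`. -/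
theorem sqrt3_mem_of_unit_triangle (K : IntermediateField ℚ ℝ) {p q r : EuclideanSpace ℝ (Fin 2)}
    (hp : p ∈ fieldPoints K) (hq : q ∈ fieldPoints K) (hr : r ∈ fieldPoints K)
    (hpq : dist p q = 1) (hpr : dist p r = 1) (hqr : dist q r = 1) : Real.sqrt 3 ∈ K := by
  set t := 2 * ((q 0 - p 0) * (r 1 - p 1) - (q 1 - p 1) * (r 0 - p 0)) with ht
  have htK : t ∈ K :=
    mul_mem (ofNat_mem K 2) (sub_mem (mul_mem (sub_mem (hq 0) (hp 0)) (sub_mem (hr 1) (hp 1)))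
      (mul_mem (sub_mem (hq 1) (hp 1)) (sub_mem (hr 0) (hp 0))))
  have h3 : t ^ 2 = 3 := sq_two_det_eq_three hpq hpr hqr
  have hs : Real.sqrt 3 = |t| := by rw [← Real.sqrt_sq_eq_abs, h3]
  rw [hs]
  rcases abs_choice t with h | h <;> rw [h]
  · exact htK
  · exact neg_mem htK

/-- If `√3 ∉ K` then the unit-distance graph on `K²` is triangle-free. -/
theorem cliqueFree_three_plane_of_sqrt3_not_mem (K : IntermediateField ℚ ℝ) (h3 : Real.sqrt 3 ∉ K) :
    (planeUnitDistanceGraph.induce (fieldPoints K)).CliqueFree 3 := by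
  intro s hs
  rw [is3Clique_iff] at hs
  obtain ⟨a, b, c, hab, hac, hbc, -⟩ := hs
  exact h3 (sqrt3_mem_of_unit_triangle K a.2 b.2 c.2 hab hac hbc)

/-- If `√3 ∈ K` then `(0,0), (1,0), (1/2, √3/2)` is a triangle of `K²`. -/
theorem not_cliqueFree_three_plane_of_sqrt3_mem (K : IntermediateField ℚ ℝ) (h3 : Real.sqrt 3 ∈ K) :
    ¬ (planeUnitDistanceGraph.induce (fieldPoints K)).CliqueFree 3 := by
  have hA : (!₂[(0 : ℝ), 0] : EuclideanSpace ℝ (Fin 2)) ∈ fieldPoints K := by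
    intro i; fin_cases i <;> simp
  have hB : (!₂[(1 : ℝ), 0] : EuclideanSpace ℝ (Fin 2)) ∈ fieldPoints K := by
    intro i; fin_cases i <;> simp
  have hC : (!₂[(1 / 2 : ℝ), Real.sqrt 3 / 2] : EuclideanSpace ℝ (Fin 2)) ∈ fieldPoints K := by
    intro i; fin_cases i
    · change (1 / 2 : ℝ) ∈ K; simp
    · change Real.sqrt 3 / 2 ∈ K; exact div_mem h3 (ofNat_mem K 2)
  have s3 : Real.sqrt 3 ^ 2 = 3 := Real.sq_sqrt (by norm_num)
  have hunit : ∀ (p q : EuclideanSpace ℝ (Fin 2)), (p 0 - q 0) ^ 2 + (p 1 - q 1) ^ 2 = 1 → dist p q = 1 := by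
    intro p q h
    have hd : dist p q ^ 2 = 1 := by rw [dist_sq_fin2, h]
    exact (pow_eq_one_iff_of_nonneg dist_nonneg two_ne_zero).1 hd
  have hAB : (planeUnitDistanceGraph.induce (fieldPoints K)).Adj ⟨_, hA⟩ ⟨_, hB⟩ := hunit _ _ (by simp)
  have hAC : (planeUnitDistanceGraph.induce (fieldPoints K)).Adj ⟨_, hA⟩ ⟨_, hC⟩ :=
    hunit _ _ (by simp; nlinarith [s3])
  have hBC : (planeUnitDistanceGraph.induce (fieldPoints K)).Adj ⟨_, hB⟩ ⟨_, hC⟩ :=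
    hunit _ _ (by simp; nlinarith [s3])
  intro hcf
  exact hcf _ (is3Clique_triple_iff.2 ⟨hAB, hAC, hBC⟩)

/-- TRIANGLE CRITERION: the unit-distance graph on `K²` is triangle-free iff `√3 ∉ K`. -/
theorem cliqueFree_three_plane_iff (K : IntermediateField ℚ ℝ) :
    (planeUnitDistanceGraph.induce (fieldPoints K)).CliqueFree 3 ↔ Real.sqrt 3 ∉ K :=
  ⟨fun h h3 => not_cliqueFree_three_plane_of_sqrt3_mem K h3 h, cliqueFree_three_plane_of_sqrt3_not_mem K⟩

/-! ## Quadratic fields: elements of `ℚ(√d)` and `√3 ∉ ℚ(√d)` -/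

/-- Every element of `ℚ(√d)` (`d : ℕ`) has the form `x + y√d` with `x, y ∈ ℚ`. -/
theorem exists_rat_of_mem_adjoin_sqrt (d : ℕ) {z : ℝ} (hz : z ∈ ℚ⟮Real.sqrt d⟯) :
    ∃ x y : ℚ, z = x + y * Real.sqrt d := by
  have hint : IsIntegral ℚ (Real.sqrt d) := by
    refine IsIntegral.of_pow two_pos ?_
    rw [Real.sq_sqrt (Nat.cast_nonneg d)]
    have h : IsIntegral ℚ ((d : ℚ) : ℝ) := isIntegral_algebraMap
    simpa using h
  have hz' : z ∈ (ℚ⟮Real.sqrt d⟯).toSubalgebra := hz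
  rw [adjoin_simple_toSubalgebra_of_isAlgebraic hint.isAlgebraic, Algebra.adjoin_singleton_eq_range_aeval] at hz'
  obtain ⟨P, hP⟩ := (AlgHom.mem_range _).1 hz'
  rw [← hP]
  clear hP hz hz'
  induction P using Polynomial.induction_on' with
  | add p q hp hq =>
      obtain ⟨x₁, y₁, h₁⟩ := hp
      obtain ⟨x₂, y₂, h₂⟩ := hq
      exact ⟨x₁ + x₂, y₁ + y₂, by rw [map_add, h₁, h₂]; push_cast; ring⟩
  | monomial n a =>
      -- `(√d)^(m+1) = y·d + x·√d` when `(√d)^m = x + y√d`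
      have s : Real.sqrt d ^ 2 = d := Real.sq_sqrt (Nat.cast_nonneg d)
      have hpow : ∀ m : ℕ, ∃ x y : ℚ, Real.sqrt d ^ m = x + y * Real.sqrt d := by
        intro m
        induction m with
        | zero => exact ⟨1, 0, by simp⟩
        | succ m hm =>
            obtain ⟨x, y, h⟩ := hm
            refine ⟨y * d, x, ?_⟩
            rw [pow_succ, h]; push_cast; linear_combination (y : ℝ) * s
      obtain ⟨x, y, h⟩ := hpow n
      refine ⟨a * x, a * y, ?_⟩
      rw [Polynomial.aeval_monomial, h, eq_ratCast]; push_cast; ring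

/-- `n` is not a perfect square if it lies strictly between consecutive squares. -/
theorem not_isSquare_of_between {n r : ℕ} (h1 : r * r < n) (h2 : n < (r + 1) * (r + 1)) : ¬ IsSquare n := by
  rintro ⟨t, rfl⟩
  have ht1 : r < t := by
    by_contra h
    exact absurd h1 (not_lt.2 (Nat.mul_le_mul (not_lt.1 h) (not_lt.1 h)))
  have ht2 : t < r + 1 := by
    by_contra h
    exact absurd h2 (not_lt.2 (Nat.mul_le_mul (not_lt.1 h) (not_lt.1 h)))
  omega

/-- If `√d` and `√(3d)` are irrational then `√3 ∉ ℚ(√d)`. -/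
theorem sqrt3_not_mem_adjoin_sqrt (d : ℕ) (hd : Irrational (Real.sqrt d)) (h3d : Irrational (Real.sqrt (3 * d))) :
    Real.sqrt 3 ∉ ℚ⟮Real.sqrt d⟯ := by
  intro hmem
  obtain ⟨x, y, h⟩ := exists_rat_of_mem_adjoin_sqrt d hmem
  have s3 : Real.sqrt 3 ^ 2 = 3 := Real.sq_sqrt (by norm_num)
  have sd : Real.sqrt d ^ 2 = d := Real.sq_sqrt (Nat.cast_nonneg d)
  have h3irr : Irrational (Real.sqrt 3) := Nat.prime_three.irrational_sqrt
  -- square the relation: `3 = x² + d y² + 2xy√d`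
  have hsq0 : Real.sqrt 3 ^ 2 = (x + y * Real.sqrt d) ^ 2 := by rw [h]
  rw [s3] at hsq0
  have hsq : (3 : ℝ) = x ^ 2 + d * y ^ 2 + 2 * x * y * Real.sqrt d := by linear_combination hsq0 + (y : ℝ) ^ 2 * sd
  by_cases hy : y = 0
  · subst hy
    exact h3irr ⟨x, by rw [h]; simp⟩
  by_cases hx : x = 0
  · subst hx
    -- `√3 = y√d` ⇒ `√(3d) = √3·√d = d·y` is rational
    have hmul : Real.sqrt (3 * d) = Real.sqrt 3 * Real.sqrt d := Real.sqrt_mul (by norm_num) _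
    refine h3d ⟨y * d, ?_⟩
    rw [hmul, h]; push_cast; linear_combination (-(y : ℝ)) * sd
  · -- `xy ≠ 0` ⇒ `√d = (3 − x² − d y²)/(2xy)` is rational
    have hxy : (2 * x * y : ℝ) ≠ 0 := by
      have hx' : (x : ℝ) ≠ 0 := by exact_mod_cast hx
      have hy' : (y : ℝ) ≠ 0 := by exact_mod_cast hy
      positivity
    refine hd ⟨(3 - x ^ 2 - d * y ^ 2) / (2 * x * y), ?_⟩
    push_cast
    rw [div_eq_iff hxy]
    linear_combination hsq

/-- `√3 ∉ ℚ(√11)` (`11` and `33` are not squares). -/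
theorem sqrt3_not_mem_adjoin_sqrt11 : Real.sqrt 3 ∉ ℚ⟮Real.sqrt 11⟯ := by
  have h33 : Irrational (Real.sqrt ((33 : ℕ) : ℝ)) :=
    irrational_sqrt_natCast_iff.2 (not_isSquare_of_between (r := 5) (by norm_num) (by norm_num))
  have h := sqrt3_not_mem_adjoin_sqrt 11 (by norm_num : Nat.Prime 11).irrational_sqrt
    (by convert h33 using 2; push_cast; norm_num)
  rw [Nat.cast_ofNat] at h
  exact h

/-- THE PLANE OVER `ℚ(√11)` IS TRIANGLE-FREE: every unit-distance graph with coordinates in `ℚ(√11)` is triangle-free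
(so any 4-chromatic one — `PlaneSqrt11Four.lean` — is a triangle-free 4-chromatic unit-distance graph). -/
theorem cliqueFree_three_plane_sqrt11 :
    (planeUnitDistanceGraph.induce (fieldPoints ℚ⟮Real.sqrt 11⟯)).CliqueFree 3 :=
  cliqueFree_three_plane_of_sqrt3_not_mem _ sqrt3_not_mem_adjoin_sqrt11

/-- Likewise `ℚ(√d)²` is triangle-free for `d = 7, 23, 35` (Madore 2015 Prop. 4.2 is the case `d = 7`). -/
theorem cliqueFree_three_plane_sqrt_7_23_35 :
    (planeUnitDistanceGraph.induce (fieldPoints ℚ⟮Real.sqrt 7⟯)).CliqueFree 3 ∧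
    (planeUnitDistanceGraph.induce (fieldPoints ℚ⟮Real.sqrt 23⟯)).CliqueFree 3 ∧
    (planeUnitDistanceGraph.induce (fieldPoints ℚ⟮Real.sqrt 35⟯)).CliqueFree 3 := by
  have h21 : Irrational (Real.sqrt ((21 : ℕ) : ℝ)) :=
    irrational_sqrt_natCast_iff.2 (not_isSquare_of_between (r := 4) (by norm_num) (by norm_num))
  have h69 : Irrational (Real.sqrt ((69 : ℕ) : ℝ)) :=
    irrational_sqrt_natCast_iff.2 (not_isSquare_of_between (r := 8) (by norm_num) (by norm_num))
  have h35 : Irrational (Real.sqrt ((35 : ℕ) : ℝ)) :=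
    irrational_sqrt_natCast_iff.2 (not_isSquare_of_between (r := 5) (by norm_num) (by norm_num))
  have h105 : Irrational (Real.sqrt ((105 : ℕ) : ℝ)) :=
    irrational_sqrt_natCast_iff.2 (not_isSquare_of_between (r := 10) (by norm_num) (by norm_num))
  have h7 := sqrt3_not_mem_adjoin_sqrt 7 (by norm_num : Nat.Prime 7).irrational_sqrt
    (by convert h21 using 2; push_cast; norm_num)
  have h23 := sqrt3_not_mem_adjoin_sqrt 23 (by norm_num : Nat.Prime 23).irrational_sqrt
    (by convert h69 using 2; push_cast; norm_num)
  have h35' := sqrt3_not_mem_adjoin_sqrt 35 h35 (by convert h105 using 2; push_cast; norm_num)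
  rw [Nat.cast_ofNat] at h7 h23 h35'
  exact ⟨cliqueFree_three_plane_of_sqrt3_not_mem _ h7, cliqueFree_three_plane_of_sqrt3_not_mem _ h23,
    cliqueFree_three_plane_of_sqrt3_not_mem _ h35'⟩

/-- A unit-distance realisation of a graph inside a triangle-free field plane is triangle-free. -/
theorem cliqueFree_three_of_realisation_in_fieldPoints {V : Type*} {G : SimpleGraph V}
    {q : V → EuclideanSpace ℝ (Fin 2)} (hq : IsUnitDistanceRealisation G q) (K : IntermediateField ℚ ℝ)
    (hK : ∀ v, q v ∈ fieldPoints K) (h3 : Real.sqrt 3 ∉ K) : G.CliqueFree 3 := by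
  classical
  intro s hs
  rw [is3Clique_iff] at hs
  obtain ⟨a, b, c, hab, hac, hbc, -⟩ := hs
  exact h3 (sqrt3_mem_of_unit_triangle K (hK a) (hK b) (hK c) (hq.2 hab) (hq.2 hac) (hq.2 hbc))

end Summit.Ventures.DiscreteObjects.UnitDistance
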